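import Summits.RiemannHypothesis.RiemannHypothesis.Theorems.TiltedLandingLaw421R3TouchedGlueW

/-!
# Glue v5, part 3 — Γ3″: the SAMPLE-AND-HOLD potential Φ̂_L and its rise law (lens-2 g7; crit-1 CUT 37 (3) «FLICKER» repair + CUT 38 note; HELD; 0 sorry)
ONE import: part 2 `…R3TouchedGlueW` (#1196; hence part 1 `…R3TouchedGlueWDefs` #1195 and the socket `…R3TouchedDissipationW` #1194).  Nothing in 40 /
41a / 41b / 45 is edited; this file ADDS the repaired potential, its rise law Γ3″ and the ★A compositions over it; part 2's Γ3′ theorems stay true but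
their hypothesis `TouchRiseLawWQ` is unfundable on storey / rain frames (below), so ★A rev 7.1 cites THIS file's `approachC_of_THQ_brackets`.
WHY (crit-1 CUT 37 (3), model level, accepted): part 1's pair-energy meter `touchEnergyQ k = lowH_k² + touchH_k²` follows THE LOWEST band state of level
`k`, whichever zero that is; the potential `Φ̃_k = Φ_L(touchEnergyQ k)` therefore DROPS when an untouched rain / plume zero is briefly the lowest state
and RISES back to `Φ_L(E_v)` when the touched lineage is lowest again, and Γ3′'s meter `touchRiseWQ` books every such identity switch
(`[Φ̃(k+1) − Φ̃(k)]⁺`): Σ rises = 0.59–3.60·(Hs/s)² on crit-1's storey frames (L1 … D3b, `crit-g5/retouch/ladder2.py` 26d9bbe0) although the frames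
spend only `N_total ≤ 0.31·(Hs/s)²` levels — the potential over-books, the frame does not over-spend.
THE REPAIR (crit-1's «lineage-local E», typed as ONE frame potential): read the energy ONLY at levels that carry a β-WITNESS (`BetaWitnessQ`, part 1:
charged, approach, lowest `v` touched atomically by `z`, field floor), and between such levels HOLD the children's energy of the last paid step:
`heldEnergyQ 0 = 2Hs²`, `heldEnergyQ (k+1) = childEnergy f k Ū_k` if level `k` has a β-witness (the chosen one; every law binder is `∀ v z`), else
`heldEnergyQ k`; `Φ̂_k := Φ_L(touchEnergyQ k)` at witness levels, `Φ_L(heldEnergyQ k)` elsewhere (so `Φ̂_0 ≤ purse` with no `firstBetaQ`); rise meter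
`ρ̂_k := [Φ̂(k+1) − Φ_L(heldEnergyQ (k+1))]⁺ + dropPenaltyHQ k`, the books' negative-drop penalty `4·[−drop_k]⁺/s` being booked ONLY at witness levels
(crit-1 CUT 38 design note: the step inequality needs it only where a unit is paid).  BOOKKEEPING (this file, (K)): at a witness level
`Φ_L(heldEnergyQ (k+1)) = Φ_L(child_k) ≤ Φ̂_k − 1` (the socket row, verbatim as in part 2), at a non-witness level `heldEnergyQ (k+1) = heldEnergyQ k`
and `Φ̂(k+1) ≤ Φ̂_k + ρ̂_k` with no penalty needed; hence `ρ̂_k = 0` UNLESS `k` OR `k+1` CARRIES A β-WITNESS (`touchRiseHQ_eq_zero_of_not_witness`), and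
its first term books `[Φ_L(E_{k+1}) − Φ_L(last paid child energy)]⁺` only when `k+1` does: (a) the RETOUCH rise RTB at consecutive witness levels exactly
as Γ3′ did, (b) the RE-ENTRY rise of a lineage after unpaid levels (≤ 0 while the pair kept contracting), (c) a LINEAGE SWITCH (a different touched
atomic lowest `v′` enters: ≤ `Φ_L(E_{v′})` ≤ purse) — and NOTHING for identity flicker or rain landings at non-witness levels.  PRE-TYPING BENCH (crit-1
CUT 38, `crit-g5/retouch/gamma3H.py` 4182fd3e, the 11 ladder frames, floats): Γ3′ → Γ3″ Σ/(Hs/s)² = D1 1.188 → 0 · D2 1.395 → 0 · D3b 3.602 → 0 · L1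
0.808 → 0 · … — the first term is 0.000 on 11/11 (the direct full-height retouch of CUT 37 (2) books nothing there: its contact level has two touchers,
so it is not a witness level, and `v` never re-enters as a witness), the witness-level penalty is 0 on 11/11, `n_entries = 1` on 11/11.
WHAT REMAINS PRICED ONLY BY BENCHES (named, not hidden; unrealised in the 11 designs): (i) an ATOMIC RE-ENTRY at full height — a retoucher at height `Hs`
that is the ONLY toucher of a lineage near the bottom at a charged approach level books `RTB → Φ_L(Hs²) = (y₁² + 2Ly₁ + 2L²)/8·(Hs/s)²` at
`c = 2, η = 1/2`, `y₁ = 1 + L·log 2` (= 0.2955 P at L = 3/10, 0.3324 P at 7/20; crit-1 CUT 37 (2), closed form confirmed); (ii) the number of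
β-LINEAGE ENTRIES per frame (each after the first books ≤ purse).  All Φ-loads scale `1/c` and the
allowance `approachBudgetHalfQ` is PER FRAME (it debits only `(5/4)·energyPurseQ = (5/4)η²·lowH₀²/s²`): the frame-free fit with ONE direct full-height
retouch closes iff `(Φ_L(2Hs²) + Φ_L(Hs²))·(2/c) + aRest ≤ 0.656·(Hs/s)²` (worst energy-purse debit), i.e. `c ≥ 2.26` at L = 3/10 — at `c = 2` it
closes on frames whose energy-purse credit is ≥ 0.085·(Hs/s)² (crit-1's L1: budget ≈ 0.97 P, loads 0.445 + 0.26).  Whether a legal charged frame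
combines the worst credit (lowH₀ ≈ hmax) with a direct full-height retouch is the bench question that decides between the instance of record
T⁗(2, 3/10, 3, 2) (`…R3TouchedDissipationWInstance`) and a `c ∈ [2.26, 3)` instance (law margin × 3/c at the corner).
★A DECOMPOSITION OF RECORD rev 7.1: C′ + T⁗(c, L, κ₀, θ) + Γ2′ + Γ3″ (`TouchRiseLawHQ`, Σ ρ̂ ≤ aT) + Γ4 + FIT_W, constants PARAMETERS.
Nothing here bears on the truth of RH; RH is not proved; T⁗ / Γ3″ / Γ4 are LAWS (typed, unproved); C′ typed not proved; ★A / 33346 / 33347 OPEN;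
floats ≠ certificates ≠ Lean; checked ≠ landed ≠ proved. -/

namespace RhW08.TouchedGlueH

open Complex
open scoped ComplexConjugate
open RhW08.Round1 RhW08.StSwap RhW08.Round2 RhW08.QuadW
open RhW08.SealSwap (PBot)
open RhW08.SealSwapQ RhW08.RateSplit RhW08.BurgersRate RhW08.BurgersRateG3 RhW08.TouchedDissipation RhW08.TouchedDissipationW
open RhIdea6.G17.W07C7 RhIdea6.G17.W07C7.Rev6 RhIdea6.G18.W07C8.Law421BirthS RhIdea6.G19.W07C11.Seam
open RhIdea6.G20.W07C12.Frac RhIdea6.G20.W07C12.StColP RhW07.C12.FieldSplit RhIdea6.G21.W07C13.TentMax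
open RhW07.C14.TwoSided RhW07.C14.Classes RhW07.C14.Lineage RhW07.C14.Booking
open RhW08.TouchedGlueW

/-! ## §H1 The held energy, the sample-and-hold potential and its rise meter -/

open Classical in
/-- §H1 the HELD ENERGY of a frame: `2Hs²` at level `0`; across a level WITH a β-witness it becomes the children's energy `childEnergy f k Ū_k` of the
chosen witness pair, across a level without one it is carried unchanged. -/
noncomputable def heldEnergyQ (κ₀ η : ℝ) (f : ℂ → ℂ) (x₀ s hmax R Hs : ℝ) (B : ℕ) : ℕ → ℝ
  | 0 => 2 * Hs ^ 2
  | k + 1 =>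
    if h : ∃ p : ℂ × ℂ, BetaWitnessQ κ₀ η f x₀ s hmax R Hs B k p then
      childEnergy f k (pairUnion (Classical.choose h).1 (Classical.choose h).2)
    else heldEnergyQ κ₀ η f x₀ s hmax R Hs B k

open Classical in
/-- §H1 the SAMPLE-AND-HOLD potential `Φ̂_k`: `Φ_L(touchEnergyQ k)` (at the frame constant `cF(F)`) at a level carrying a β-witness, `Φ_L(heldEnergyQ k)`
at every other level — the pair energy is READ only where it is paid. -/
noncomputable def betaPotentialHQ (cF : Budget) (L κ₀ : ℝ) : LevelMeter := fun η f x₀ s hmax R Hs B k =>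
  if ∃ p : ℂ × ℂ, BetaWitnessQ κ₀ η f x₀ s hmax R Hs B k p then
    phiLE (cF η f x₀ s hmax R Hs B) L η s Hs (touchEnergyQ η f x₀ s hmax R Hs B k)
  else phiLE (cF η f x₀ s hmax R Hs B) L η s Hs (heldEnergyQ κ₀ η f x₀ s hmax R Hs B k)

open Classical in
/-- §H1 the NEGATIVE-DROP PENALTY `4·[−drop_k]⁺/s`, booked ONLY at levels carrying a β-witness (crit-1 CUT 38 design note: the books' step inequality
needs it only where a unit is paid; at unpaid levels a rain zero landing below `v` makes `lowH` jump up for free). -/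
noncomputable def dropPenaltyHQ (κ₀ : ℝ) : LevelMeter := fun η f x₀ s hmax R Hs B k =>
  if ∃ p : ℂ × ℂ, BetaWitnessQ κ₀ η f x₀ s hmax R Hs B k p then 4 * max (-dropQ η f x₀ s hmax R Hs B k) 0 / s else 0

/-- §H1 the RISE METER `ρ̂_k := [Φ̂(k+1) − Φ_L(heldEnergyQ (k+1))]⁺ + dropPenaltyHQ k`: the re-entry / retouch / lineage-switch rise INTO level `k+1`
(zero unless `k+1` carries a β-witness) plus the negative-drop penalty at witness levels (zero unless `k` carries one). -/
noncomputable def touchRiseHQ (cF : Budget) (L κ₀ : ℝ) : LevelMeter := fun η f x₀ s hmax R Hs B k =>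
  max (betaPotentialHQ cF L κ₀ η f x₀ s hmax R Hs B (k + 1)
      - phiLE (cF η f x₀ s hmax R Hs B) L η s Hs (heldEnergyQ κ₀ η f x₀ s hmax R Hs B (k + 1))) 0
    + dropPenaltyHQ κ₀ η f x₀ s hmax R Hs B k

/-! ## §H2 The named gap Γ3″ (typed, OPEN — a hypothesis of the glue, not a sorry) -/

/-- (Γ3″, OPEN as to SIZE — LOAD-BEARING; supersedes Γ3′ `TouchRiseLawWQ` of part 2) RISE ALLOWANCE in Φ̂ units: before the horizon the booked
rises `touchRiseHQ` (re-entries, retouches, lineage switches — no identity flicker) stay within `aT`. -/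
def TouchRiseLawHQ (cF : Budget) (L κ₀ : ℝ) (aT : Budget) : Prop :=
  ∀ (η : ℝ) (f : ℂ → ℂ) (x₀ s hmax R Hs : ℝ) (B : ℕ), EngineHyps5 2 η f x₀ s hmax R Hs B →
    ∀ k : ℕ, Charged (PTrkSQ PBot) StTrkDQ ReadyR2 η f x₀ s hmax R Hs B k →
      prefixSumQ (touchRiseHQ cF L κ₀) η f x₀ s hmax R Hs B (k + 1) ≤ aT η f x₀ s hmax R Hs B

/-! ## §H3 Bookkeeping of the held energy and of Φ̂ (K) -/

/-- (K) a β-witness at level `k` is exactly «`k` charged and in the β class». -/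
theorem betaWitness_iff {κ₀ η : ℝ} {f : ℂ → ℂ} {x₀ s hmax R Hs : ℝ} {B k : ℕ} :
    (∃ p : ℂ × ℂ, BetaWitnessQ κ₀ η f x₀ s hmax R Hs B k p) ↔
      Charged (PTrkSQ PBot) StTrkDQ ReadyR2 η f x₀ s hmax R Hs B k ∧ BetaLevelQ κ₀ η f x₀ s hmax R Hs B k :=
  ⟨fun ⟨p, hch, happ, hlow, ht, ha, hfl⟩ => ⟨hch, happ, p.1, p.2, hlow, ht, ha, hfl⟩,
    fun ⟨hch, happ, v, z, hlow, ht, ha, hfl⟩ => ⟨(v, z), hch, happ, hlow, ht, ha, hfl⟩⟩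

/-- (K) the held energy at level `0` is `2Hs²`. -/
theorem heldEnergyQ_zero (κ₀ η : ℝ) (f : ℂ → ℂ) (x₀ s hmax R Hs : ℝ) (B : ℕ) :
    heldEnergyQ κ₀ η f x₀ s hmax R Hs B 0 = 2 * Hs ^ 2 := rfl

open Classical in
/-- (K) across a witness level the held energy becomes the chosen pair's children's energy. -/
theorem heldEnergyQ_succ_of_witness {κ₀ η : ℝ} {f : ℂ → ℂ} {x₀ s hmax R Hs : ℝ} {B k : ℕ}
    (h : ∃ p : ℂ × ℂ, BetaWitnessQ κ₀ η f x₀ s hmax R Hs B k p) :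
    heldEnergyQ κ₀ η f x₀ s hmax R Hs B (k + 1) = childEnergy f k (pairUnion (Classical.choose h).1 (Classical.choose h).2) := by
  rw [heldEnergyQ, dif_pos h]

/-- (K) across a level without a β-witness the held energy is carried. -/
theorem heldEnergyQ_succ_of_not {κ₀ η : ℝ} {f : ℂ → ℂ} {x₀ s hmax R Hs : ℝ} {B k : ℕ}
    (h : ¬ ∃ p : ℂ × ℂ, BetaWitnessQ κ₀ η f x₀ s hmax R Hs B k p) :
    heldEnergyQ κ₀ η f x₀ s hmax R Hs B (k + 1) = heldEnergyQ κ₀ η f x₀ s hmax R Hs B k := by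
  rw [heldEnergyQ, dif_neg h]

/-- (K) the held energy is non-negative. -/
theorem heldEnergyQ_nonneg (κ₀ η : ℝ) (f : ℂ → ℂ) (x₀ s hmax R Hs : ℝ) (B : ℕ) : ∀ k : ℕ, 0 ≤ heldEnergyQ κ₀ η f x₀ s hmax R Hs B k
  | 0 => by rw [heldEnergyQ_zero]; positivity
  | k + 1 => by
    by_cases h : ∃ p : ℂ × ℂ, BetaWitnessQ κ₀ η f x₀ s hmax R Hs B k p
    · rw [heldEnergyQ_succ_of_witness h]; exact childEnergy_nonneg _ _ _
    · rw [heldEnergyQ_succ_of_not h]; exact heldEnergyQ_nonneg κ₀ η f x₀ s hmax R Hs B k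

/-- (K) Φ̂ at a witness level reads the pair-energy meter. -/
theorem betaPotentialHQ_of_witness {cF : Budget} {L κ₀ η : ℝ} {f : ℂ → ℂ} {x₀ s hmax R Hs : ℝ} {B k : ℕ}
    (h : ∃ p : ℂ × ℂ, BetaWitnessQ κ₀ η f x₀ s hmax R Hs B k p) : betaPotentialHQ cF L κ₀ η f x₀ s hmax R Hs B k
      = phiLE (cF η f x₀ s hmax R Hs B) L η s Hs (touchEnergyQ η f x₀ s hmax R Hs B k) := by
  unfold betaPotentialHQ; rw [if_pos h]

/-- (K) Φ̂ off the witness levels reads the held energy. -/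
theorem betaPotentialHQ_of_not {cF : Budget} {L κ₀ η : ℝ} {f : ℂ → ℂ} {x₀ s hmax R Hs : ℝ} {B k : ℕ}
    (h : ¬ ∃ p : ℂ × ℂ, BetaWitnessQ κ₀ η f x₀ s hmax R Hs B k p) : betaPotentialHQ cF L κ₀ η f x₀ s hmax R Hs B k
      = phiLE (cF η f x₀ s hmax R Hs B) L η s Hs (heldEnergyQ κ₀ η f x₀ s hmax R Hs B k) := by
  unfold betaPotentialHQ; rw [if_neg h]

/-- (K) the penalty at a witness level. -/
theorem dropPenaltyHQ_of_witness {κ₀ η : ℝ} {f : ℂ → ℂ} {x₀ s hmax R Hs : ℝ} {B k : ℕ}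
    (h : ∃ p : ℂ × ℂ, BetaWitnessQ κ₀ η f x₀ s hmax R Hs B k p) :
    dropPenaltyHQ κ₀ η f x₀ s hmax R Hs B k = 4 * max (-dropQ η f x₀ s hmax R Hs B k) 0 / s := by
  unfold dropPenaltyHQ; rw [if_pos h]

/-- (K) no penalty off the witness levels. -/
theorem dropPenaltyHQ_of_not {κ₀ η : ℝ} {f : ℂ → ℂ} {x₀ s hmax R Hs : ℝ} {B k : ℕ}
    (h : ¬ ∃ p : ℂ × ℂ, BetaWitnessQ κ₀ η f x₀ s hmax R Hs B k p) : dropPenaltyHQ κ₀ η f x₀ s hmax R Hs B k = 0 := by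
  unfold dropPenaltyHQ; rw [if_neg h]

/-- (K) the penalty is non-negative when `0 ≤ s`. -/
theorem dropPenaltyHQ_nonneg (κ₀ η : ℝ) (f : ℂ → ℂ) (x₀ : ℝ) {s : ℝ} (hmax R Hs : ℝ) (B k : ℕ) (hs : 0 ≤ s) :
    0 ≤ dropPenaltyHQ κ₀ η f x₀ s hmax R Hs B k := by
  unfold dropPenaltyHQ; split_ifs <;> positivity

/-- ★ (K) **NO FLICKER**: if neither `k` nor `k+1` carries a β-witness the rise meter books NOTHING — identity switches of the lowest state and rain
zeros landing below `v` at unpaid levels cost `0` (crit-1 CUT 38: Σρ̂ = 0.000·(Hs/s)² on all 11 ladder frames, vs Γ3′'s 0.31–3.60). -/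
theorem touchRiseHQ_eq_zero_of_not_witness {cF : Budget} {L κ₀ η : ℝ} {f : ℂ → ℂ} {x₀ s hmax R Hs : ℝ} {B k : ℕ}
    (hk : ¬ ∃ p : ℂ × ℂ, BetaWitnessQ κ₀ η f x₀ s hmax R Hs B k p) (hk1 : ¬ ∃ p : ℂ × ℂ, BetaWitnessQ κ₀ η f x₀ s hmax R Hs B (k + 1) p) :
    touchRiseHQ cF L κ₀ η f x₀ s hmax R Hs B k = 0 := by
  unfold touchRiseHQ; rw [betaPotentialHQ_of_not hk1, dropPenaltyHQ_of_not hk, sub_self, max_self, add_zero]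

/-- (K) at a level `k+1` WITH a β-witness the rise meter books `[Φ_L(E_{k+1}) − Φ_L(heldEnergyQ (k+1))]⁺` (re-entry / retouch / switch) + penalty. -/
theorem touchRiseHQ_of_witness_succ {cF : Budget} {L κ₀ η : ℝ} {f : ℂ → ℂ} {x₀ s hmax R Hs : ℝ} {B k : ℕ}
    (h : ∃ p : ℂ × ℂ, BetaWitnessQ κ₀ η f x₀ s hmax R Hs B (k + 1) p) :
    touchRiseHQ cF L κ₀ η f x₀ s hmax R Hs B k
      = max (phiLE (cF η f x₀ s hmax R Hs B) L η s Hs (touchEnergyQ η f x₀ s hmax R Hs B (k + 1))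
            - phiLE (cF η f x₀ s hmax R Hs B) L η s Hs (heldEnergyQ κ₀ η f x₀ s hmax R Hs B (k + 1))) 0
        + dropPenaltyHQ κ₀ η f x₀ s hmax R Hs B k := by
  unfold touchRiseHQ; rw [betaPotentialHQ_of_witness h]

/-- (K) the rise meter is non-negative (for the FIT's sign bookkeeping). -/
theorem touchRiseHQ_nonneg (cF : Budget) (L κ₀ η : ℝ) (f : ℂ → ℂ) (x₀ : ℝ) {s : ℝ} (hmax R Hs : ℝ) (B k : ℕ) (hs : 0 ≤ s) :
    0 ≤ touchRiseHQ cF L κ₀ η f x₀ s hmax R Hs B k := by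
  unfold touchRiseHQ
  exact add_nonneg (le_max_right _ _) (dropPenaltyHQ_nonneg κ₀ η f x₀ hmax R Hs B k hs)

/-! ## §H4 ★ The β class law from the socket + Γ3″ — PROVED -/

open Classical in
set_option maxHeartbeats 800000 in
/-- ★★ (K) **W(cF) + Γ3″ ⟹ the β CLASS LAW** with allowance `betaPurseWQ cF L + aT`, by the books' socket `classLawQ_of_potential_rises` with `Φ = Φ̂`
and rise meter `ρ̂ = touchRiseHQ`: at a charged β-level `k` (a witness exists, so `Φ̂_k = Φ_L(E_k)` and `heldEnergyQ (k+1) = childEnergy Ū_k`)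
`Φ_L(E_k) ≥ Φ_L(e_k) ≥ Φ_L(childEnergy Ū_k) + 1 ≥ Φ̂(k+1) − ρ̂_k + 1`; off such levels `heldEnergyQ (k+1) = heldEnergyQ k` and `Φ̂(k+1) ≤ Φ̂_k + ρ̂_k`. -/
theorem betaClassLaw_of_TH {cF : Budget} {L κ₀ : ℝ} {aT : Budget}
    (hcF : ∀ (η : ℝ) (f : ℂ → ℂ) (x₀ s hmax R Hs : ℝ) (B : ℕ), EngineHyps5 2 η f x₀ s hmax R Hs B → 0 < cF η f x₀ s hmax R Hs B)
    (hL : 0 ≤ L) (hT : TouchedDissipationLawWQ cF L κ₀) (hrise : TouchRiseLawHQ cF L κ₀ aT) :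
    ClassLawQ (BetaLevelQ κ₀) (addBudget (betaPurseWQ cF L) aT) := by
  refine classLawQ_of_potential_rises (betaPotentialHQ cF L κ₀) (touchRiseHQ cF L κ₀) ?_
  intro η f x₀ s hmax R Hs B hE
  have hc : 0 < cF η f x₀ s hmax R Hs B := hcF η f x₀ s hmax R Hs B hE
  have hs : 0 < s := hE.2.2.2.1
  have hHs0 : 0 ≤ Hs := hE.2.2.2.2.2.2.2.1
  have hη0 : 0 ≤ η := hE.2.2.2.2.2.2.2.2.2.2.2.2.2.1
  have hη1 : 2 * η ≤ 1 := hE.2.2.2.2.2.2.2.2.2.2.2.2.2.2.1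
  refine ⟨fun k => ?_, ?_, fun k hk => hrise η f x₀ s hmax R Hs B hE k hk, fun k _ => ?_⟩
  · by_cases hw : ∃ p : ℂ × ℂ, BetaWitnessQ κ₀ η f x₀ s hmax R Hs B k p
    · rw [betaPotentialHQ_of_witness hw]; exact phiLE_nonneg hc L η s Hs (touchEnergyQ_nonneg η f x₀ s hmax R Hs B k)
    · rw [betaPotentialHQ_of_not hw]; exact phiLE_nonneg hc L η s Hs (heldEnergyQ_nonneg κ₀ η f x₀ s hmax R Hs B k)
  · show betaPotentialHQ cF L κ₀ η f x₀ s hmax R Hs B 0 ≤ betaPurseWQ cF L η f x₀ s hmax R Hs B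
    rw [betaPurseWQ_apply]
    by_cases hw : ∃ p : ℂ × ℂ, BetaWitnessQ κ₀ η f x₀ s hmax R Hs B 0 p
    · rw [betaPotentialHQ_of_witness hw]
      exact phiLE_le_purse hc hL hs hη0 hη1 hHs0 (touchEnergyQ_nonneg η f x₀ s hmax R Hs B 0) (touchEnergyQ_le hE 0)
    · rw [betaPotentialHQ_of_not hw, heldEnergyQ_zero]
      exact phiLE_le_purse hc hL hs hη0 hη1 hHs0 (by positivity) le_rfl
  · -- the step across level `k`
    have hdrop : -(4 * dropQ η f x₀ s hmax R Hs B k / s) ≤ 4 * max (-dropQ η f x₀ s hmax R Hs B k) 0 / s := by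
      rw [← neg_div, ← mul_neg]
      exact div_le_div_of_nonneg_right (mul_le_mul_of_nonneg_left (le_max_left _ _) (by norm_num)) hs.le
    have hd0 : 0 ≤ dropPenaltyHQ κ₀ η f x₀ s hmax R Hs B k := dropPenaltyHQ_nonneg κ₀ η f x₀ hmax R Hs B k hs.le
    have hρ : betaPotentialHQ cF L κ₀ η f x₀ s hmax R Hs B (k + 1)
        - phiLE (cF η f x₀ s hmax R Hs B) L η s Hs (heldEnergyQ κ₀ η f x₀ s hmax R Hs B (k + 1))
        ≤ max (betaPotentialHQ cF L κ₀ η f x₀ s hmax R Hs B (k + 1)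
            - phiLE (cF η f x₀ s hmax R Hs B) L η s Hs (heldEnergyQ κ₀ η f x₀ s hmax R Hs B (k + 1))) 0 := le_max_left _ _
    by_cases hj : Charged (PTrkSQ PBot) StTrkDQ ReadyR2 η f x₀ s hmax R Hs B k ∧ BetaLevelQ κ₀ η f x₀ s hmax R Hs B k
    · rw [if_pos hj]
      have hex : ∃ p : ℂ × ℂ, BetaWitnessQ κ₀ η f x₀ s hmax R Hs B k p := betaWitness_iff.2 hj
      obtain ⟨hch', happ', hlow', ht', ha', hfl'⟩ := Classical.choose_spec hex
      have hΦk : betaPotentialHQ cF L κ₀ η f x₀ s hmax R Hs B k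
          = phiLE (cF η f x₀ s hmax R Hs B) L η s Hs (touchEnergyQ η f x₀ s hmax R Hs B k) := betaPotentialHQ_of_witness hex
      have hheld : heldEnergyQ κ₀ η f x₀ s hmax R Hs B (k + 1)
          = childEnergy f k (pairUnion (Classical.choose hex).1 (Classical.choose hex).2) := heldEnergyQ_succ_of_witness hex
      have hpen : dropPenaltyHQ κ₀ η f x₀ s hmax R Hs B k = 4 * max (-dropQ η f x₀ s hmax R Hs B k) 0 / s :=
        dropPenaltyHQ_of_witness hex
      -- the chosen pair's energies
      have hrow := hT η f x₀ s hmax R Hs B hE k _ _ hch' happ' hlow' ht' ha' hfl'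
      have hΔ0 := drop_nonneg_of_lawWQ hT hE hc hch' happ' hlow' ht' ha' hfl'
      obtain ⟨he2, hHs⟩ := pair_le_twoHsSq hE hlow' ht'
      have hcE0 : 0 ≤ childEnergy f k (pairUnion (Classical.choose hex).1 (Classical.choose hex).2) := childEnergy_nonneg _ _ _
      have hcEe : childEnergy f k (pairUnion (Classical.choose hex).1 (Classical.choose hex).2)
          ≤ (Classical.choose hex).1.im ^ 2 + (Classical.choose hex).2.im ^ 2 := by linarith
      have heE := pair_le_touchEnergyQ hE hlow' ht'
      have hEk2 := touchEnergyQ_le hE k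
      -- (1) the potential pays at least one unit between the pair energy and the children's energy
      have htan := phiLE_sub_ge (η := η) (s := s) hc hL hHs hcE0 hcEe he2
      have hunit : 1 ≤ η ^ 2 / (cF η f x₀ s hmax R Hs B * s ^ 2)
          * (logWeight L Hs ((Classical.choose hex).1.im ^ 2 + (Classical.choose hex).2.im ^ 2) ^ 2
            * (((Classical.choose hex).1.im ^ 2 + (Classical.choose hex).2.im ^ 2)
              - childEnergy f k (pairUnion (Classical.choose hex).1 (Classical.choose hex).2))) := by
        rw [div_mul_eq_mul_div, le_div_iff₀ (by positivity), one_mul]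
        linarith
      have hpay := hunit.trans htan
      -- (2) monotonicity from the pair energy up to the meter
      have hmono := phiLE_mono (η := η) (s := s) hc hL hHs (by positivity) heE hEk2
      show betaPotentialHQ cF L κ₀ η f x₀ s hmax R Hs B (k + 1) + (1 - 4 * dropQ η f x₀ s hmax R Hs B k / s)
        ≤ betaPotentialHQ cF L κ₀ η f x₀ s hmax R Hs B k
          + (max (betaPotentialHQ cF L κ₀ η f x₀ s hmax R Hs B (k + 1)
                - phiLE (cF η f x₀ s hmax R Hs B) L η s Hs (heldEnergyQ κ₀ η f x₀ s hmax R Hs B (k + 1))) 0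
            + dropPenaltyHQ κ₀ η f x₀ s hmax R Hs B k)
      rw [hheld] at hρ ⊢
      rw [hΦk, hpen]
      linarith
    · rw [if_neg hj, add_zero]
      have hnw : ¬ ∃ p : ℂ × ℂ, BetaWitnessQ κ₀ η f x₀ s hmax R Hs B k p := fun h => hj (betaWitness_iff.1 h)
      have hΦk := betaPotentialHQ_of_not (cF := cF) (L := L) hnw
      have hheld := heldEnergyQ_succ_of_not hnw
      show betaPotentialHQ cF L κ₀ η f x₀ s hmax R Hs B (k + 1)
        ≤ betaPotentialHQ cF L κ₀ η f x₀ s hmax R Hs B k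
          + (max (betaPotentialHQ cF L κ₀ η f x₀ s hmax R Hs B (k + 1)
                - phiLE (cF η f x₀ s hmax R Hs B) L η s Hs (heldEnergyQ κ₀ η f x₀ s hmax R Hs B (k + 1))) 0
            + dropPenaltyHQ κ₀ η f x₀ s hmax R Hs B k)
      rw [hheld] at hρ ⊢
      rw [hΦk]
      linarith

/-! ## §H5 ★★ Composition to ★A's literal type (rev 7.1) -/

/-- ★★ (K, modulo the NAMED hypotheses) **THE GLUE v5 / rev 7.1**: W(cF) with `cF > 0` on legal frames + (Γ3″) RISE ALLOWANCE + (Γ4) the rest of the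
approach class + FIT_W ⟹ `ApproachAllowanceQ (approachBudgetHalfQ aR aC)` for ANY budgets `aR aC` the fit is stated against. -/
theorem approachC_of_TH {cF : Budget} {L κ₀ : ℝ} {aT aRest aR aC : Budget}
    (hcF : ∀ (η : ℝ) (f : ℂ → ℂ) (x₀ s hmax R Hs : ℝ) (B : ℕ), EngineHyps5 2 η f x₀ s hmax R Hs B → 0 < cF η f x₀ s hmax R Hs B)
    (hL : 0 ≤ L) (hT : TouchedDissipationLawWQ cF L κ₀) (hrise : TouchRiseLawHQ cF L κ₀ aT)
    (hrest : ClassLawQ (diffClass ApproachLevelQ (BetaLevelQ κ₀)) aRest)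
    (hfit : ∀ (η : ℝ) (f : ℂ → ℂ) (x₀ s hmax R Hs : ℝ) (B : ℕ), EngineHyps5 2 η f x₀ s hmax R Hs B →
      betaPurseWQ cF L η f x₀ s hmax R Hs B + aT η f x₀ s hmax R Hs B + aRest η f x₀ s hmax R Hs B
        ≤ approachBudgetHalfQ aR aC η f x₀ s hmax R Hs B) :
    ApproachAllowanceQ (approachBudgetHalfQ aR aC) :=
  classLawQ_mono (approachAllowanceQ_of_beta_rest (betaClassLaw_of_TH hcF hL hT hrise) hrest)
    (fun η f x₀ s hmax R Hs B hE => by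
      show betaPurseWQ cF L η f x₀ s hmax R Hs B + aT η f x₀ s hmax R Hs B + aRest η f x₀ s hmax R Hs B ≤ _
      exact hfit η f x₀ s hmax R Hs B hE)

/-- ★★ (K) the CANONICAL instance — literally the registry's `stub_approachC` conclusion `ApproachAllowanceQ (approachBudgetHalfQ riseSupQ consSupQ)`. -/
theorem approachC_of_TH_canonical {cF : Budget} {L κ₀ : ℝ} {aT aRest : Budget}
    (hcF : ∀ (η : ℝ) (f : ℂ → ℂ) (x₀ s hmax R Hs : ℝ) (B : ℕ), EngineHyps5 2 η f x₀ s hmax R Hs B → 0 < cF η f x₀ s hmax R Hs B)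
    (hL : 0 ≤ L) (hT : TouchedDissipationLawWQ cF L κ₀) (hrise : TouchRiseLawHQ cF L κ₀ aT)
    (hrest : ClassLawQ (diffClass ApproachLevelQ (BetaLevelQ κ₀)) aRest)
    (hfit : ∀ (η : ℝ) (f : ℂ → ℂ) (x₀ s hmax R Hs : ℝ) (B : ℕ), EngineHyps5 2 η f x₀ s hmax R Hs B →
      betaPurseWQ cF L η f x₀ s hmax R Hs B + aT η f x₀ s hmax R Hs B + aRest η f x₀ s hmax R Hs B
        ≤ approachBudgetHalfQ riseSupQ consSupQ η f x₀ s hmax R Hs B) :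
    ApproachAllowanceQ (approachBudgetHalfQ riseSupQ consSupQ) :=
  approachC_of_TH hcF hL hT hrise hrest hfit

/-- (K) the weighted purse of T⁗ is at most the TWO BRACKETS `φ₀·(Hs/s)² + φ₀·θ·(B+1)`, `φ₀ = (1+2L+2L²)/(2c)` (since `w_F ≤ 1 + θ·(B+1)·(s/Hs)²`). -/
theorem betaPurseWQ_le_brackets {c L θ : ℝ} (hc : 0 < c) (hL : 0 ≤ L) (hθ : 0 ≤ θ)
    {η : ℝ} {f : ℂ → ℂ} {x₀ s hmax R Hs : ℝ} {B : ℕ} (hs : 0 < s) :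
    betaPurseWQ (weightedConstQ c θ) L η f x₀ s hmax R Hs B
      ≤ (1 + 2 * L + 2 * L ^ 2) / (2 * c) * (Hs / s) ^ 2 + (1 + 2 * L + 2 * L ^ 2) / (2 * c) * θ * ((B : ℝ) + 1) := by
  have hq : 0 ≤ 1 + 2 * L + 2 * L ^ 2 := by nlinarith
  have hw := frameWeightQ_le hθ η f x₀ s hmax R Hs B
  have hw0 := frameWeightQ_pos θ η f x₀ s hmax R Hs B
  have hprod : (Hs / s) ^ 2 * (s / Hs) ^ 2 ≤ 1 := by
    by_cases hHs : Hs = 0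
    · rw [hHs]; simp
    · rw [← mul_pow, div_mul_div_comm, mul_comm Hs s, div_self (mul_ne_zero hs.ne' hHs)]; norm_num
  have hp : betaPurseWQ (weightedConstQ c θ) L η f x₀ s hmax R Hs B
      = (1 + 2 * L + 2 * L ^ 2) / (2 * c) * (Hs / s) ^ 2 * frameWeightQ θ η f x₀ s hmax R Hs B := by
    rw [betaPurseWQ_apply]; unfold weightedConstQ; field_simp
  rw [hp]
  have hφ0 : 0 ≤ (1 + 2 * L + 2 * L ^ 2) / (2 * c) * (Hs / s) ^ 2 := by positivity
  calc (1 + 2 * L + 2 * L ^ 2) / (2 * c) * (Hs / s) ^ 2 * frameWeightQ θ η f x₀ s hmax R Hs B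
      ≤ (1 + 2 * L + 2 * L ^ 2) / (2 * c) * (Hs / s) ^ 2 * (1 + θ * ((B : ℝ) + 1) * (s / Hs) ^ 2) :=
        mul_le_mul_of_nonneg_left hw hφ0
    _ = (1 + 2 * L + 2 * L ^ 2) / (2 * c) * (Hs / s) ^ 2
        + (1 + 2 * L + 2 * L ^ 2) / (2 * c) * θ * ((B : ℝ) + 1) * ((Hs / s) ^ 2 * (s / Hs) ^ 2) := by ring
    _ ≤ (1 + 2 * L + 2 * L ^ 2) / (2 * c) * (Hs / s) ^ 2 + (1 + 2 * L + 2 * L ^ 2) / (2 * c) * θ * ((B : ℝ) + 1) * 1 := by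
        have hk : 0 ≤ (1 + 2 * L + 2 * L ^ 2) / (2 * c) * θ * ((B : ℝ) + 1) := by positivity
        linarith [mul_le_mul_of_nonneg_left hprod hk]
    _ = _ := by ring

/-- ★★ (K) **T⁗ INSTANCE WITH THE TWO-BRACKET FIT_W over Γ3″**: T⁗(c, L, κ₀, θ) + Γ3″ + Γ4 + the bracket fit give ★A at the canonical budgets
(★A rev 7.1; with the instance of record `…R3TouchedDissipationWInstance` one takes `c = 2, L = 3/10, κ₀ = 3, θ = thetaW`). -/
theorem approachC_of_THQ_brackets {c L κ₀ θ : ℝ} {aT aRest : Budget} (hc : 0 < c) (hL : 0 ≤ L) (hθ : 0 ≤ θ)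
    (hT : TouchedDissipationLawTQ c L κ₀ θ) (hrise : TouchRiseLawHQ (weightedConstQ c θ) L κ₀ aT)
    (hrest : ClassLawQ (diffClass ApproachLevelQ (BetaLevelQ κ₀)) aRest)
    (hfit : ∀ (η : ℝ) (f : ℂ → ℂ) (x₀ s hmax R Hs : ℝ) (B : ℕ), EngineHyps5 2 η f x₀ s hmax R Hs B →
      (1 + 2 * L + 2 * L ^ 2) / (2 * c) * (Hs / s) ^ 2 + (1 + 2 * L + 2 * L ^ 2) / (2 * c) * θ * ((B : ℝ) + 1)
        + aT η f x₀ s hmax R Hs B + aRest η f x₀ s hmax R Hs B ≤ approachBudgetHalfQ riseSupQ consSupQ η f x₀ s hmax R Hs B) :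
    ApproachAllowanceQ (approachBudgetHalfQ riseSupQ consSupQ) :=
  approachC_of_TH (fun η f x₀ s hmax R Hs B _ => weightedConstQ_pos hc θ η f x₀ s hmax R Hs B) hL hT hrise hrest
    (fun η f x₀ s hmax R Hs B hE => by
      linarith [betaPurseWQ_le_brackets hc hL hθ (η := η) (f := f) (x₀ := x₀) (hmax := hmax) (R := R) (Hs := Hs) (B := B) hE.2.2.2.1,
        hfit η f x₀ s hmax R Hs B hE])

end RhW08.TouchedGlueH
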